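import Mathlib
import Literature.Analysis.FluidPDE.PassiveVectorTensorModalAdjointCoeff
import Literature.Analysis.FluidPDE.PassiveVectorTensorUniqueness

/-!
# W7 · F-p4g13-1 (vector layer) — the three-mode form inequality for PROJECTED VECTOR modes with ANISOTROPIC damping

Kernel companion of `Lines/onelevel_W7_threemode.lean` §2 (memo `Lines/onelevel-W7-threemode.md` §2, caveat §7 «vector/anisotropic
Young steps hand + numerics only»): here they are kernel-checked, in an ABSTRACT real inner-product space, so that the W7 prover's step S2
is an instantiation.

Setting (one slot, one Bloch fibre, five consecutive chain modes `0, ±1, ±2`, coupling `ℓ` frozen): vectors `w₀ w₊ w₋ w₊₊ w₋₋ : E`,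
"dampings" `y_j` (= `D_j w_j`, any vectors with `d_j‖w_j‖² ≤ ⟪y_j, w_j⟫`, `‖y_±‖ ≤ Dmax‖w_±‖`, `‖y₀‖ ≤ D0‖w₀‖`, `P_± y_± = y_±`),
maps `P₀ P₊ P₋ : E → E` that are self-adjoint and idempotent (orthogonal projections; no linearity is used).  The chain vector field
(`IsotropicCubatureWord`/`LatticePhase.layer` units, phases gauged away):
`ẇ₀ = −y₀ + ℓ P₀(w₊ − w₋)`, `ẇ₊ = −y₊ − ℓ (P₊ w₀ − P₊ w₊₊)`, `ẇ₋ = −y₋ − ℓ (P₋ w₋₋ − P₋ w₀)`.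
Cross term `X = ⟪w₀, b⟫`, `b = ℓ P₀(w₊ − w₋)`; `xdotV` below is `⟪ẇ₀, b⟫ + ⟪w₀, ḃ⟫` with `ℓ` frozen (the ramp `ℓ̇` term is `ramp_term_le`
of the scalar file, it only needs `‖b‖ ≤ ℓ(‖w₊‖+‖w₋‖)`).

* `young_disc`                 — `c x z ≤ a x² + b z²` from `c² ≤ 4ab`.
* `threeModeV_scalars_le`      — the inequality on the finitely many real quantities (norms, the five inner products), given the
                                  Cauchy–Schwarz bounds: pure real arithmetic, explicit Young squares.
* `xdotV_expand`               — the inner-product expansion of `⟪ẇ₀, b⟫ + ⟪w₀, ḃ⟫` under the projection axioms.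
* `threeModeV_form_le`         — THE VECTOR FORM INEQUALITY:
  `−2 Σ_j ⟪y_j, w_j⟫ + ε·xdotV ≤ −(εℓ²/2)(‖P₊w₀‖² + ‖P₋w₀‖²) − (5 d_min/4)(‖w₊‖² + ‖w₋‖²) − d₂(‖w₊₊‖² + ‖w₋₋‖²) − (7d₀/4)‖w₀‖²`
  under `8εℓ² ≤ d_min`, `4ε Dmax² ≤ d_min`, `εℓ² ≤ d₂`, `32 ε²ℓ² D0² ≤ d₀ d_min`.
  The drain form is `Q̂(w₀) = ‖P₊w₀‖² + ‖P₋w₀‖²` (memo §2: `= slotTerm`'s polarisation factor); the window anisotropy enters only through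
  `Dmax, D0, d_j`.  NO regime restriction on `k̃` is needed: with (c1), `32ε²ℓ²D0² = 4ε·(8εℓ²)·D0² ≤ 4ε·d_min·D0²`, so (c4) follows from
  `4εD0² ≤ d₀`; in the window `d₀ ≥ 4π²νk̃²(lo/Λ)`, `D0 ≤ 4π²νk̃²(hiΛ+β)`, and the memo's `ε ≤ d_min/(4Dmax²) ≤ (lo/Λ)/(16π²ν|m|²(hiΛ+β)²)`,
  hence `4εD0² ≤ d₀ ⟸ k̃² ≤ |m|²` — always (k̃ ≤ √3/2 < 1 ≤ |m|).  So the memo's (R1) bare-dissipation regime `k̃ ≥ k̃_*` is a convenience,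
  not a necessity.  The conclusion leaves `5d_min/4` on `±1`; the ramp term (`ramp_term_le` of the scalar file, fed by `rampV_pairing_le`)
  uses `d_min/2` of it, ending at the memo's `3d_min/4`.
* `threeModeV_equiv`, `rampV_pairing_le` — norm equivalence `2|εX| ≤ εℓ√2·E₃` and the pairing bound the ramp step needs.
What the W7 prover instantiates: `E :=` the real Hilbert space `EuclideanSpace ℂ (Fin 3)` viewed over ℝ (or the fibre plane), `P_j :=`
`transversalProj (K_j)` (PassiveVectorTensorModalAdjointCoeff, p664222), `y_j := 4π²·P_j(symbT 𝔸 K_j)P_j w_j`, `d_j, Dmax, D0` from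
`NearIso`/`OddSmall` (`lo_mul_le_re_inner_symbT`), `l := a_s(t)·k̃(ê_s·q̂)/(2|m_s|)`.

v2 (same path) = v1 (39060944ff15) + **§F FIBRE INSTANTIATION** on `ℂ³ = EuclideanSpace ℂ (Fin 3)` with the tree's objects (S2 of p5 g10's
engine plan): `inner_transversalProj_comm` / `transversalProj_idem` (the Leray projection `Torus.transversalProj K` is a ℂ-self-adjoint idempotent),
`re_inner_modalAdjGen_ge` (coercivity `4π²·lo·|K|²‖w‖² ≤ Re⟪modalAdjGen 𝔸 K w, w⟫` for `kdot K w = 0` under `NearIso 𝔸 lo hi` — discharges the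
`hg_j` hypotheses with `d_j = 4π² lo |K_j|²`), the concrete chain right-hand sides `dW0C/dWpC/dWmC/bC/xdotC` (real coefficients acting as `(l:ℂ)•`),
and `threeModeC3_form_le` / `threeModeC3_equiv` / `rampC3_pairing_le` = the abstract theorems instantiated through
`InnerProductSpace.rclikeToReal ℂ` INSIDE the proofs (statements purely in `(⟪·,·⟫_ℂ).re`, `‖·‖`; transversality as `kdot`-conditions).
v3 adds **§F5 the UPPER NORM BOUND** `norm_modalAdjGen_le : kdot K w = 0 → ‖modalAdjGen 𝔸 K w‖ ≤ 4π²·(hi + β/2)·|K|²·‖w‖` under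
`NearIso 𝔸 lo hi` (`0 ≤ lo`, `0 ≤ hi`) and `OddSmall 𝔸 β` (`0 ≤ β`) — via `bsymb_add_left/right` (bilinearity in the vectors), `bsymb_symm_sq_le`
(Cauchy–Schwarz for the positive symmetrised transverse form, `discrim_le_zero`), `abs_bsymb_le` (`|β_𝔸(k;p,q)| ≤ (hi + β/2)|k|²|p||q|` on transversal
pairs), `re_inner_symbT_bilin` (bilinear version of `re_inner_symbT_eq`), `re_inner_symbT_le`; so the `Dmax`/`D0` hypotheses are DISCHARGED too
(`Dmax = D0 := 4π²(hi+β/2)|K_j|²`).  What remains for the prover (S1): the identification of the Leray-projected Bloch-fibre chain ODE of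
`cellField W …` with `dW0C/dWpC/dWmC` (phases gauged, `l = a_s k̃ (ê_s·q̂)/(2|m_s|)`), and the Grönwall/period/design spine (p5 g10 (b)).

-/

set_option linter.dupNamespace false

namespace Summit.AnomalousDissipation.AnomalousDissipation.Cruxes.LagrangianRenormalisationStep.ThreeMode

open scoped InnerProductSpace

/-- Young with a discriminant condition: `c x z ≤ a x² + b z²` whenever `0 ≤ a`, `0 ≤ b`, `c² ≤ 4ab`. -/
theorem young_disc (a b c x z : ℝ) (ha : 0 ≤ a) (hb : 0 ≤ b) (h : c ^ 2 ≤ 4 * a * b) :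
    c * x * z ≤ a * x ^ 2 + b * z ^ 2 := by
  rcases eq_or_lt_of_le ha with h0 | hpos
  · have hc : c = 0 := by
      have : c ^ 2 ≤ 0 := by rw [← h0] at h; simpa using h
      exact pow_eq_zero_iff (n := 2) (by norm_num) |>.mp (le_antisymm this (sq_nonneg c))
    subst hc; rw [← h0]; simp; positivity
  · have key : 0 ≤ 4 * a * (a * x ^ 2 + b * z ^ 2 - c * x * z) := by
      have : 4 * a * (a * x ^ 2 + b * z ^ 2 - c * x * z) = (2 * a * x - c * z) ^ 2 + (4 * a * b - c ^ 2) * z ^ 2 := by ring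
      rw [this]; nlinarith [sq_nonneg (2 * a * x - c * z), sq_nonneg z]
    nlinarith

/-- `|b|²` step: `e l² nb² ≤ (dmin/4)(np² + nm²)` from `nb ≤ np + nm`, `8 e l² ≤ dmin`. -/
theorem stepB (e l dmin nb np nm : ℝ) (he : 0 ≤ e) (hnb0 : 0 ≤ nb) (hnb : nb ≤ np + nm)
    (c1 : 8 * e * l ^ 2 ≤ dmin) : e * (l ^ 2 * nb ^ 2) ≤ (dmin / 4) * (np ^ 2 + nm ^ 2) := by
  have hel2 : 0 ≤ e * l ^ 2 := mul_nonneg he (sq_nonneg l)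
  have h1 : nb ^ 2 ≤ (np + nm) ^ 2 := pow_le_pow_left₀ hnb0 hnb 2
  have h2 : (np + nm) ^ 2 ≤ 2 * (np ^ 2 + nm ^ 2) := by nlinarith [sq_nonneg (np - nm)]
  have h3 : e * l ^ 2 * nb ^ 2 ≤ e * l ^ 2 * (2 * (np ^ 2 + nm ^ 2)) :=
    mul_le_mul_of_nonneg_left (h1.trans h2) hel2
  have hs : 0 ≤ np ^ 2 + nm ^ 2 := by positivity
  have h4 : e * l ^ 2 * (2 * (np ^ 2 + nm ^ 2)) ≤ (dmin / 4) * (np ^ 2 + nm ^ 2) := by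
    have := mul_le_mul_of_nonneg_right c1 hs
    linarith
  linarith

/-- `y₀`-cross step: `e l |s0| ≤ (d0/8) n0² + (dmin/8)(np² + nm²)` from `|s0| ≤ D0 n0 nb`, `nb ≤ np + nm`,
`32 e² l² D0² ≤ d0 dmin`. -/
theorem stepY0 (e l d0 dmin D0 n0 nb np nm s0 : ℝ) (he : 0 ≤ e) (hl : 0 ≤ l) (hd0 : 0 ≤ d0) (hdmin : 0 ≤ dmin)
    (hD0 : 0 ≤ D0) (hn0 : 0 ≤ n0) (hnb : nb ≤ np + nm) (hs0 : |s0| ≤ D0 * n0 * nb)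
    (c4 : 32 * e ^ 2 * l ^ 2 * D0 ^ 2 ≤ d0 * dmin) :
    e * (l * |s0|) ≤ (d0 / 8) * n0 ^ 2 + (dmin / 8) * (np ^ 2 + nm ^ 2) := by
  have hel : 0 ≤ e * l := mul_nonneg he hl
  have h0 : D0 * n0 * nb ≤ D0 * n0 * (np + nm) := mul_le_mul_of_nonneg_left hnb (mul_nonneg hD0 hn0)
  have h1 : e * (l * |s0|) ≤ (e * l * D0) * n0 * (np + nm) := by
    have := mul_le_mul_of_nonneg_left (hs0.trans h0) hel
    linarith
  have h2 : (e * l * D0) * n0 * (np + nm) ≤ (d0 / 8) * n0 ^ 2 + (dmin / 16) * (np + nm) ^ 2 := by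
    apply young_disc _ _ _ _ _ (by positivity) (by positivity)
    nlinarith
  have h3 : (dmin / 16) * (np + nm) ^ 2 ≤ (dmin / 8) * (np ^ 2 + nm ^ 2) := by
    nlinarith [sq_nonneg (np - nm)]
  linarith

/-- `y_±`-cross step: `e l |sp| ≤ (e l²/4) a² + (dmin/4) np²` from `|sp| ≤ Dmax a np`, `4 e Dmax² ≤ dmin`. -/
theorem stepY1 (e l dmin Dmax a np sp : ℝ) (he : 0 ≤ e) (hl : 0 ≤ l) (hsp : |sp| ≤ Dmax * a * np)
    (c2 : 4 * e * Dmax ^ 2 ≤ dmin) : e * (l * |sp|) ≤ (e * l ^ 2 / 4) * a ^ 2 + (dmin / 4) * np ^ 2 := by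
  have h1 : e * (l * |sp|) ≤ e * (l * (Dmax * a * np)) :=
    mul_le_mul_of_nonneg_left (mul_le_mul_of_nonneg_left hsp hl) he
  have h2 : l * (Dmax * a * np) ≤ l ^ 2 / 4 * a ^ 2 + Dmax ^ 2 * np ^ 2 := by
    nlinarith [sq_nonneg (l * a / 2 - Dmax * np)]
  have h3 : e * (l * (Dmax * a * np)) ≤ e * (l ^ 2 / 4 * a ^ 2 + Dmax ^ 2 * np ^ 2) := mul_le_mul_of_nonneg_left h2 he
  have h4 : e * (Dmax ^ 2 * np ^ 2) ≤ (dmin / 4) * np ^ 2 := by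
    have := mul_le_mul_of_nonneg_right c2 (sq_nonneg np)
    linarith
  linarith

/-- `±2` step: `e l² |tp| ≤ (e l²/4) a² + dtwo npp²` from `|tp| ≤ a npp`, `e l² ≤ dtwo`. -/
theorem stepP2 (e l dtwo a npp tp : ℝ) (he : 0 ≤ e) (htp : |tp| ≤ a * npp) (c3 : e * l ^ 2 ≤ dtwo) :
    e * (l ^ 2 * |tp|) ≤ (e * l ^ 2 / 4) * a ^ 2 + dtwo * npp ^ 2 := by
  have hel2 : 0 ≤ e * l ^ 2 := mul_nonneg he (sq_nonneg l)
  have h1 : e * (l ^ 2 * |tp|) ≤ e * l ^ 2 * (a * npp) := by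
    have := mul_le_mul_of_nonneg_left htp hel2
    linarith
  have h2 : a * npp ≤ a ^ 2 / 4 + npp ^ 2 := by nlinarith [sq_nonneg (a / 2 - npp)]
  have h3 : e * l ^ 2 * (a * npp) ≤ e * l ^ 2 * (a ^ 2 / 4 + npp ^ 2) := mul_le_mul_of_nonneg_left h2 hel2
  have h4 : e * l ^ 2 * npp ^ 2 ≤ dtwo * npp ^ 2 := mul_le_mul_of_nonneg_right c3 (sq_nonneg npp)
  linarith

set_option maxHeartbeats 800000 in
/-- The three-mode VECTOR inequality reduced to its real quantities.  Variables: `l` = ℓ, `e` = ε; norms `n0 np nm npp nmm` of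
`w₀ w₊ w₋ w₊₊ w₋₋`, `a = ‖P₊w₀‖`, `bq = ‖P₋w₀‖`, `nb = ‖P₀(w₊−w₋)‖`; inner products `s0 = ⟪y₀, P₀(w₊−w₋)⟫`, `sp = ⟪P₊w₀, y₊⟫`,
`sm = ⟪P₋w₀, y₋⟫`, `tp = ⟪P₊w₀, w₊₊⟫`, `tm = ⟪P₋w₀, w₋₋⟫`; dissipations `g_j = ⟪y_j, w_j⟫`. -/
theorem threeModeV_scalars_le
    (l e d0 dp dm dpp dmm dmin dtwo Dmax D0 n0 np nm npp nmm a bq nb s0 sp sm tp tm g0 gp gm gpp gmm : ℝ)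
    (hl : 0 ≤ l) (he : 0 ≤ e) (hd0 : 0 ≤ d0) (hdmin : 0 ≤ dmin) (hD0 : 0 ≤ D0)
    (hn0 : 0 ≤ n0) (hnb0 : 0 ≤ nb) (hnb : nb ≤ np + nm)
    (hs0 : |s0| ≤ D0 * n0 * nb) (hsp : |sp| ≤ Dmax * a * np) (hsm : |sm| ≤ Dmax * bq * nm)
    (htp : |tp| ≤ a * npp) (htm : |tm| ≤ bq * nmm)
    (hg0 : d0 * n0 ^ 2 ≤ g0) (hgp : dp * np ^ 2 ≤ gp) (hgm : dm * nm ^ 2 ≤ gm) (hgpp : dpp * npp ^ 2 ≤ gpp)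
    (hgmm : dmm * nmm ^ 2 ≤ gmm)
    (hp : dmin ≤ dp) (hm : dmin ≤ dm) (hpp : dtwo ≤ dpp) (hmm : dtwo ≤ dmm)
    (c1 : 8 * e * l ^ 2 ≤ dmin) (c2 : 4 * e * Dmax ^ 2 ≤ dmin) (c3 : e * l ^ 2 ≤ dtwo)
    (c4 : 32 * e ^ 2 * l ^ 2 * D0 ^ 2 ≤ d0 * dmin) :
    -2 * (g0 + gp + gm + gpp + gmm)
        + e * (l ^ 2 * nb ^ 2 - l * s0 - l * sp + l * sm - l ^ 2 * (a ^ 2 + bq ^ 2) + l ^ 2 * tp + l ^ 2 * tm)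
      ≤ -(e * l ^ 2 / 2) * (a ^ 2 + bq ^ 2) - (5 * dmin / 4) * (np ^ 2 + nm ^ 2) - dtwo * (npp ^ 2 + nmm ^ 2)
        - (7 * d0 / 4) * n0 ^ 2 := by
  have y1 := stepB e l dmin nb np nm he hnb0 hnb c1
  have y2 := stepY0 e l d0 dmin D0 n0 nb np nm s0 he hl hd0 hdmin hD0 hn0 hnb hs0 c4
  have y3 := stepY1 e l dmin Dmax a np sp he hl hsp c2
  have y4 := stepY1 e l dmin Dmax bq nm sm he hl hsm c2
  have y5 := stepP2 e l dtwo a npp tp he htp c3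
  have y6 := stepP2 e l dtwo bq nmm tm he htm c3
  -- the raw terms are bounded by their absolute values
  have a0 : e * (-(l * s0)) ≤ e * (l * |s0|) := by
    refine mul_le_mul_of_nonneg_left ?_ he
    rw [← mul_neg]; exact mul_le_mul_of_nonneg_left (neg_le_abs s0) hl
  have ap : e * (-(l * sp)) ≤ e * (l * |sp|) := by
    refine mul_le_mul_of_nonneg_left ?_ he
    rw [← mul_neg]; exact mul_le_mul_of_nonneg_left (neg_le_abs sp) hl
  have am : e * (l * sm) ≤ e * (l * |sm|) :=
    mul_le_mul_of_nonneg_left (mul_le_mul_of_nonneg_left (le_abs_self sm) hl) he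
  have bp : e * (l ^ 2 * tp) ≤ e * (l ^ 2 * |tp|) :=
    mul_le_mul_of_nonneg_left (mul_le_mul_of_nonneg_left (le_abs_self tp) (sq_nonneg l)) he
  have bm : e * (l ^ 2 * tm) ≤ e * (l ^ 2 * |tm|) :=
    mul_le_mul_of_nonneg_left (mul_le_mul_of_nonneg_left (le_abs_self tm) (sq_nonneg l)) he
  -- dissipation lower bounds
  have gp' : dmin * np ^ 2 ≤ gp := (mul_le_mul_of_nonneg_right hp (sq_nonneg np)).trans hgp
  have gm' : dmin * nm ^ 2 ≤ gm := (mul_le_mul_of_nonneg_right hm (sq_nonneg nm)).trans hgm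
  have gpp' : dtwo * npp ^ 2 ≤ gpp := (mul_le_mul_of_nonneg_right hpp (sq_nonneg npp)).trans hgpp
  have gmm' : dtwo * nmm ^ 2 ≤ gmm := (mul_le_mul_of_nonneg_right hmm (sq_nonneg nmm)).trans hgmm
  have hn0sq : 0 ≤ d0 * n0 ^ 2 := by positivity
  have hnp2 : 0 ≤ dmin * np ^ 2 := mul_nonneg hdmin (sq_nonneg np)
  have hnm2 : 0 ≤ dmin * nm ^ 2 := mul_nonneg hdmin (sq_nonneg nm)
  have expand : e * (l ^ 2 * nb ^ 2 - l * s0 - l * sp + l * sm - l ^ 2 * (a ^ 2 + bq ^ 2) + l ^ 2 * tp + l ^ 2 * tm)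
      = e * (l ^ 2 * nb ^ 2) + e * (-(l * s0)) + e * (-(l * sp)) + e * (l * sm) - e * l ^ 2 * (a ^ 2 + bq ^ 2)
        + e * (l ^ 2 * tp) + e * (l ^ 2 * tm) := by ring
  rw [expand]
  linarith only [y1, y2, y3, y4, y5, y6, a0, ap, am, bp, bm, hg0, gp', gm', gpp', gmm', hn0sq, hnp2, hnm2]

/-! ## The inner-product layer -/

section Vector

variable {E : Type*} [NormedAddCommGroup E] [InnerProductSpace ℝ E]

/-- A self-adjoint idempotent map does not increase norms. -/
theorem norm_proj_le (P : E → E) (hsa : ∀ x z : E, ⟪P x, z⟫_ℝ = ⟪x, P z⟫_ℝ) (hid : ∀ x : E, P (P x) = P x) (x : E) :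
    ‖P x‖ ≤ ‖x‖ := by
  have h : ‖P x‖ ^ 2 ≤ ‖x‖ * ‖P x‖ := by
    calc ‖P x‖ ^ 2 = ⟪P x, P x⟫_ℝ := (real_inner_self_eq_norm_sq _).symm
      _ = ⟪x, P (P x)⟫_ℝ := hsa x (P x)
      _ = ⟪x, P x⟫_ℝ := by rw [hid]
      _ ≤ ‖x‖ * ‖P x‖ := real_inner_le_norm _ _
  nlinarith [h, norm_nonneg x, norm_nonneg (P x)]

/-- The chain right-hand sides of modes `0, +1, −1` (coupling `l` frozen, phases gauged):
`ẇ₀ = −y₀ + l•P₀(w₊ − w₋)`, `ẇ₊ = −y₊ − l•(P₊w₀ − P₊w₊₊)`, `ẇ₋ = −y₋ − l•(P₋w₋₋ − P₋w₀)`. -/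
def dW0 (l : ℝ) (P0 : E → E) (wp wm y0 : E) : E := -y0 + l • P0 (wp - wm)
/-- see `dW0` -/
def dWp (l : ℝ) (Pp : E → E) (w0 wpp yp : E) : E := -yp - l • (Pp w0 - Pp wpp)
/-- see `dW0` -/
def dWm (l : ℝ) (Pm : E → E) (w0 wmm ym : E) : E := -ym - l • (Pm wmm - Pm w0)
/-- The cross vector `b = l • P₀(w₊ − w₋)` (`= ẇ₀ + y₀`). -/
def bV (l : ℝ) (P0 : E → E) (wp wm : E) : E := l • P0 (wp - wm)

/-- `xdotV = ⟪ẇ₀, b⟫ + ⟪w₀, l • P₀(ẇ₊ − ẇ₋)⟫` — the time derivative of the cross term `X = ⟪w₀, b⟫` along the chain with `l`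
frozen (for a linear continuous `P₀`, `ḃ = l • P₀(ẇ₊ − ẇ₋)`; the `l̇` part is `ramp_term_le` of the scalar file). -/
def xdotV (l : ℝ) (P0 Pp Pm : E → E) (w0 wp wm wpp wmm y0 yp ym : E) : ℝ :=
  ⟪dW0 l P0 wp wm y0, bV l P0 wp wm⟫_ℝ + ⟪w0, l • P0 (dWp l Pp w0 wpp yp - dWm l Pm w0 wmm ym)⟫_ℝ

theorem bV_eq_dW0_add (l : ℝ) (P0 : E → E) (wp wm y0 : E) : bV l P0 wp wm = dW0 l P0 wp wm y0 + y0 := by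
  simp [bV, dW0]

/-- EXPANSION of `xdotV` under the projection axioms (self-adjoint, idempotent; `P₀w₀ = w₀`, `P_±y_± = y_±`). -/
theorem xdotV_expand (l : ℝ) (P0 Pp Pm : E → E) (w0 wp wm wpp wmm y0 yp ym : E)
    (hP0sa : ∀ x z : E, ⟪P0 x, z⟫_ℝ = ⟪x, P0 z⟫_ℝ) (hw0 : P0 w0 = w0)
    (hPpsa : ∀ x z : E, ⟪Pp x, z⟫_ℝ = ⟪x, Pp z⟫_ℝ) (hPpid : ∀ x : E, Pp (Pp x) = Pp x) (hyp : Pp yp = yp)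
    (hPmsa : ∀ x z : E, ⟪Pm x, z⟫_ℝ = ⟪x, Pm z⟫_ℝ) (hPmid : ∀ x : E, Pm (Pm x) = Pm x) (hym : Pm ym = ym) :
    xdotV l P0 Pp Pm w0 wp wm wpp wmm y0 yp ym
      = l ^ 2 * ‖P0 (wp - wm)‖ ^ 2 - l * ⟪y0, P0 (wp - wm)⟫_ℝ - l * ⟪Pp w0, yp⟫_ℝ + l * ⟪Pm w0, ym⟫_ℝ
        - l ^ 2 * (‖Pp w0‖ ^ 2 + ‖Pm w0‖ ^ 2) + l ^ 2 * ⟪Pp w0, wpp⟫_ℝ + l ^ 2 * ⟪Pm w0, wmm⟫_ℝ := by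
  have e1 : ⟪dW0 l P0 wp wm y0, bV l P0 wp wm⟫_ℝ = -(l * ⟪y0, P0 (wp - wm)⟫_ℝ) + l ^ 2 * ‖P0 (wp - wm)‖ ^ 2 := by
    simp only [dW0, bV, inner_add_left, inner_neg_left, real_inner_smul_right,
      real_inner_self_eq_norm_sq, norm_smul, mul_pow, Real.norm_eq_abs, sq_abs]
    try ring
  have e2 : ⟪w0, l • P0 (dWp l Pp w0 wpp yp - dWm l Pm w0 wmm ym)⟫_ℝ
      = l * ⟪w0, dWp l Pp w0 wpp yp - dWm l Pm w0 wmm ym⟫_ℝ := by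
    rw [real_inner_smul_right, ← hP0sa, hw0]
  have h1 : ⟪w0, yp⟫_ℝ = ⟪Pp w0, yp⟫_ℝ := by
    calc ⟪w0, yp⟫_ℝ = ⟪w0, Pp yp⟫_ℝ := by rw [hyp]
      _ = ⟪Pp w0, yp⟫_ℝ := (hPpsa w0 yp).symm
  have h2 : ⟪w0, Pp w0⟫_ℝ = ‖Pp w0‖ ^ 2 := by
    calc ⟪w0, Pp w0⟫_ℝ = ⟪w0, Pp (Pp w0)⟫_ℝ := by rw [hPpid]
      _ = ⟪Pp w0, Pp w0⟫_ℝ := (hPpsa w0 (Pp w0)).symm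
      _ = ‖Pp w0‖ ^ 2 := real_inner_self_eq_norm_sq _
  have h3 : ⟪w0, Pp wpp⟫_ℝ = ⟪Pp w0, wpp⟫_ℝ := (hPpsa w0 wpp).symm
  have h1' : ⟪w0, ym⟫_ℝ = ⟪Pm w0, ym⟫_ℝ := by
    calc ⟪w0, ym⟫_ℝ = ⟪w0, Pm ym⟫_ℝ := by rw [hym]
      _ = ⟪Pm w0, ym⟫_ℝ := (hPmsa w0 ym).symm
  have h2' : ⟪w0, Pm w0⟫_ℝ = ‖Pm w0‖ ^ 2 := by
    calc ⟪w0, Pm w0⟫_ℝ = ⟪w0, Pm (Pm w0)⟫_ℝ := by rw [hPmid]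
      _ = ⟪Pm w0, Pm w0⟫_ℝ := (hPmsa w0 (Pm w0)).symm
      _ = ‖Pm w0‖ ^ 2 := real_inner_self_eq_norm_sq _
  have h3' : ⟪w0, Pm wmm⟫_ℝ = ⟪Pm w0, wmm⟫_ℝ := (hPmsa w0 wmm).symm
  have e3 : ⟪w0, dWp l Pp w0 wpp yp - dWm l Pm w0 wmm ym⟫_ℝ
      = -⟪Pp w0, yp⟫_ℝ - l * ‖Pp w0‖ ^ 2 + l * ⟪Pp w0, wpp⟫_ℝ + ⟪Pm w0, ym⟫_ℝ + l * ⟪Pm w0, wmm⟫_ℝ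
        - l * ‖Pm w0‖ ^ 2 := by
    simp only [dWp, dWm, inner_sub_right, inner_neg_right, real_inner_smul_right, h1, h2, h3,
      h1', h2', h3']
    ring
  unfold xdotV
  rw [e1, e2, e3]
  ring

set_option maxHeartbeats 800000 in
/-- THE VECTOR THREE-MODE FORM INEQUALITY (memo §2, anisotropic window, projected modes).  Hypotheses: projection axioms;
dissipation `d_j‖w_j‖² ≤ ⟪y_j, w_j⟫`; damping sizes `‖y_±‖ ≤ Dmax‖w_±‖`, `‖y₀‖ ≤ D0‖w₀‖`; `d_min ≤ d_±`, `d₂ ≤ d_{±2}`; smallness of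
`e = ε`: `8εl² ≤ d_min`, `4εDmax² ≤ d_min`, `εl² ≤ d₂`, `32ε²l²D0² ≤ d₀d_min`.  Conclusion: the drain `−(εl²/2)·(‖P₊w₀‖²+‖P₋w₀‖²)`
on the slow mode with `5d_min/4` left on `±1` (of which the ramp uses `d_min/2`), `d₂` on `±2`, `7d₀/4` on mode 0. -/
theorem threeModeV_form_le (l e d0 dp dm dpp dmm dmin dtwo Dmax D0 : ℝ) (P0 Pp Pm : E → E)
    (w0 wp wm wpp wmm y0 yp ym ypp ymm : E)
    (hP0sa : ∀ x z : E, ⟪P0 x, z⟫_ℝ = ⟪x, P0 z⟫_ℝ) (hP0id : ∀ x : E, P0 (P0 x) = P0 x) (hw0 : P0 w0 = w0)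
    (hPpsa : ∀ x z : E, ⟪Pp x, z⟫_ℝ = ⟪x, Pp z⟫_ℝ) (hPpid : ∀ x : E, Pp (Pp x) = Pp x) (hyp : Pp yp = yp)
    (hPmsa : ∀ x z : E, ⟪Pm x, z⟫_ℝ = ⟪x, Pm z⟫_ℝ) (hPmid : ∀ x : E, Pm (Pm x) = Pm x) (hym : Pm ym = ym)
    (hl : 0 ≤ l) (he : 0 ≤ e) (hd0 : 0 ≤ d0) (hdmin : 0 ≤ dmin) (hD0 : 0 ≤ D0)
    (hg0 : d0 * ‖w0‖ ^ 2 ≤ ⟪y0, w0⟫_ℝ) (hgp : dp * ‖wp‖ ^ 2 ≤ ⟪yp, wp⟫_ℝ) (hgm : dm * ‖wm‖ ^ 2 ≤ ⟪ym, wm⟫_ℝ)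
    (hgpp : dpp * ‖wpp‖ ^ 2 ≤ ⟪ypp, wpp⟫_ℝ) (hgmm : dmm * ‖wmm‖ ^ 2 ≤ ⟪ymm, wmm⟫_ℝ)
    (hYp : ‖yp‖ ≤ Dmax * ‖wp‖) (hYm : ‖ym‖ ≤ Dmax * ‖wm‖) (hY0 : ‖y0‖ ≤ D0 * ‖w0‖)
    (hp : dmin ≤ dp) (hm : dmin ≤ dm) (hpp : dtwo ≤ dpp) (hmm : dtwo ≤ dmm)
    (c1 : 8 * e * l ^ 2 ≤ dmin) (c2 : 4 * e * Dmax ^ 2 ≤ dmin) (c3 : e * l ^ 2 ≤ dtwo)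
    (c4 : 32 * e ^ 2 * l ^ 2 * D0 ^ 2 ≤ d0 * dmin) :
    -2 * (⟪y0, w0⟫_ℝ + ⟪yp, wp⟫_ℝ + ⟪ym, wm⟫_ℝ + ⟪ypp, wpp⟫_ℝ + ⟪ymm, wmm⟫_ℝ)
        + e * xdotV l P0 Pp Pm w0 wp wm wpp wmm y0 yp ym
      ≤ -(e * l ^ 2 / 2) * (‖Pp w0‖ ^ 2 + ‖Pm w0‖ ^ 2) - (5 * dmin / 4) * (‖wp‖ ^ 2 + ‖wm‖ ^ 2)
        - dtwo * (‖wpp‖ ^ 2 + ‖wmm‖ ^ 2) - (7 * d0 / 4) * ‖w0‖ ^ 2 := by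
  rw [xdotV_expand l P0 Pp Pm w0 wp wm wpp wmm y0 yp ym hP0sa hw0 hPpsa hPpid hyp hPmsa hPmid hym]
  have hnb : ‖P0 (wp - wm)‖ ≤ ‖wp‖ + ‖wm‖ := (norm_proj_le P0 hP0sa hP0id _).trans (norm_sub_le _ _)
  have hs0 : |⟪y0, P0 (wp - wm)⟫_ℝ| ≤ D0 * ‖w0‖ * ‖P0 (wp - wm)‖ :=
    (abs_real_inner_le_norm _ _).trans (mul_le_mul_of_nonneg_right hY0 (norm_nonneg _))
  have hsp : |⟪Pp w0, yp⟫_ℝ| ≤ Dmax * ‖Pp w0‖ * ‖wp‖ := by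
    calc |⟪Pp w0, yp⟫_ℝ| ≤ ‖Pp w0‖ * ‖yp‖ := abs_real_inner_le_norm _ _
      _ ≤ ‖Pp w0‖ * (Dmax * ‖wp‖) := mul_le_mul_of_nonneg_left hYp (norm_nonneg _)
      _ = Dmax * ‖Pp w0‖ * ‖wp‖ := by ring
  have hsm : |⟪Pm w0, ym⟫_ℝ| ≤ Dmax * ‖Pm w0‖ * ‖wm‖ := by
    calc |⟪Pm w0, ym⟫_ℝ| ≤ ‖Pm w0‖ * ‖ym‖ := abs_real_inner_le_norm _ _
      _ ≤ ‖Pm w0‖ * (Dmax * ‖wm‖) := mul_le_mul_of_nonneg_left hYm (norm_nonneg _)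
      _ = Dmax * ‖Pm w0‖ * ‖wm‖ := by ring
  have htp : |⟪Pp w0, wpp⟫_ℝ| ≤ ‖Pp w0‖ * ‖wpp‖ := abs_real_inner_le_norm _ _
  have htm : |⟪Pm w0, wmm⟫_ℝ| ≤ ‖Pm w0‖ * ‖wmm‖ := abs_real_inner_le_norm _ _
  have := threeModeV_scalars_le l e d0 dp dm dpp dmm dmin dtwo Dmax D0 ‖w0‖ ‖wp‖ ‖wm‖ ‖wpp‖ ‖wmm‖ ‖Pp w0‖ ‖Pm w0‖
    ‖P0 (wp - wm)‖ ⟪y0, P0 (wp - wm)⟫_ℝ ⟪Pp w0, yp⟫_ℝ ⟪Pm w0, ym⟫_ℝ ⟪Pp w0, wpp⟫_ℝ ⟪Pm w0, wmm⟫_ℝ ⟪y0, w0⟫_ℝ ⟪yp, wp⟫_ℝ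
    ⟪ym, wm⟫_ℝ ⟪ypp, wpp⟫_ℝ ⟪ymm, wmm⟫_ℝ hl he hd0 hdmin hD0 (norm_nonneg _) (norm_nonneg _) hnb hs0 hsp hsm htp htm hg0 hgp
    hgm hgpp hgmm hp hm hpp hmm c1 c2 c3 c4
  linarith only [this]

/-- NORM EQUIVALENCE of the vector functional: `2|e·⟪w₀, b⟫| ≤ e·l·√2·(‖w₀‖² + ‖w₊‖² + ‖w₋‖²)` — so `εl√2 ≤ 1/4` gives
`(7/8)E ≤ Φ ≤ (9/8)E`. -/
theorem threeModeV_equiv (l e : ℝ) (P0 : E → E) (w0 wp wm : E)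
    (hP0sa : ∀ x z : E, ⟪P0 x, z⟫_ℝ = ⟪x, P0 z⟫_ℝ) (hP0id : ∀ x : E, P0 (P0 x) = P0 x) (hl : 0 ≤ l) (he : 0 ≤ e) :
    2 * |e * ⟪w0, bV l P0 wp wm⟫_ℝ| ≤ e * l * Real.sqrt 2 * (‖w0‖ ^ 2 + ‖wp‖ ^ 2 + ‖wm‖ ^ 2) := by
  have hnb : ‖P0 (wp - wm)‖ ≤ ‖wp‖ + ‖wm‖ := (norm_proj_le P0 hP0sa hP0id _).trans (norm_sub_le _ _)
  have h1 : |e * ⟪w0, bV l P0 wp wm⟫_ℝ| = e * l * |⟪w0, P0 (wp - wm)⟫_ℝ| := by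
    simp only [bV, real_inner_smul_right, abs_mul, abs_of_nonneg he, abs_of_nonneg hl]; ring
  have h2 : |⟪w0, P0 (wp - wm)⟫_ℝ| ≤ ‖w0‖ * (‖wp‖ + ‖wm‖) :=
    (abs_real_inner_le_norm _ _).trans (mul_le_mul_of_nonneg_left hnb (norm_nonneg _))
  have hs : Real.sqrt 2 * Real.sqrt 2 = 2 := Real.mul_self_sqrt (by norm_num)
  have hs0 : 0 ≤ Real.sqrt 2 := Real.sqrt_nonneg 2
  have hs0' : 0 < Real.sqrt 2 := Real.sqrt_pos.mpr (by norm_num)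
  have h3 : 2 * (‖w0‖ * (‖wp‖ + ‖wm‖)) ≤ Real.sqrt 2 * (‖w0‖ ^ 2 + ‖wp‖ ^ 2 + ‖wm‖ ^ 2) := by
    have hq : (‖wp‖ + ‖wm‖) ^ 2 ≤ 2 * (‖wp‖ ^ 2 + ‖wm‖ ^ 2) := by nlinarith [sq_nonneg (‖wp‖ - ‖wm‖)]
    have hx : 2 * Real.sqrt 2 * (‖w0‖ * (‖wp‖ + ‖wm‖)) ≤ 2 * ‖w0‖ ^ 2 + (‖wp‖ + ‖wm‖) ^ 2 := by
      nlinarith [sq_nonneg (Real.sqrt 2 * ‖w0‖ - (‖wp‖ + ‖wm‖)), hs]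
    have h' : Real.sqrt 2 * (Real.sqrt 2 * (‖w0‖ ^ 2 + ‖wp‖ ^ 2 + ‖wm‖ ^ 2))
        = 2 * (‖w0‖ ^ 2 + ‖wp‖ ^ 2 + ‖wm‖ ^ 2) := by rw [← mul_assoc, hs]
    have key : Real.sqrt 2 * (2 * (‖w0‖ * (‖wp‖ + ‖wm‖)))
        ≤ Real.sqrt 2 * (Real.sqrt 2 * (‖w0‖ ^ 2 + ‖wp‖ ^ 2 + ‖wm‖ ^ 2)) := by
      rw [h']; linarith
    exact le_of_mul_le_mul_left key hs0'
  rw [h1]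
  have hel : 0 ≤ e * l := mul_nonneg he hl
  nlinarith [mul_le_mul_of_nonneg_left (h2.trans (by nlinarith [h3] : ‖w0‖ * (‖wp‖ + ‖wm‖) ≤
    Real.sqrt 2 / 2 * (‖w0‖ ^ 2 + ‖wp‖ ^ 2 + ‖wm‖ ^ 2))) hel]

/-- RAMP TERM, vector form: the `l̇`-part of `Ẋ` is `(l̇/l)·⟪w₀, b⟫`; with `b = l•P₀(w₊−w₋)` it is bounded exactly as in
`ramp_term_le`: `|⟪w₀, P₀(w₊ − w₋)⟫| ≤ ‖w₀‖(‖w₊‖ + ‖w₋‖)`. -/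
theorem rampV_pairing_le (P0 : E → E) (w0 wp wm : E)
    (hP0sa : ∀ x z : E, ⟪P0 x, z⟫_ℝ = ⟪x, P0 z⟫_ℝ) (hP0id : ∀ x : E, P0 (P0 x) = P0 x) :
    |⟪w0, P0 (wp - wm)⟫_ℝ| ≤ ‖w0‖ * (‖wp‖ + ‖wm‖) :=
  (abs_real_inner_le_norm _ _).trans
    (mul_le_mul_of_nonneg_left ((norm_proj_le P0 hP0sa hP0id _).trans (norm_sub_le _ _)) (norm_nonneg _))

end Vector


/-! # §F — FIBRE INSTANTIATION on `ℂ³` (v2) -/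

section Fibre

open Literature.Analysis.FluidPDE Literature.Analysis.FluidPDE.Torus

/-- The fibre space `ℂ³`. -/
abbrev C3 := EuclideanSpace ℂ (Fin 3)

/-! ## §1 The Leray projection at a wave vector is a self-adjoint idempotent -/

theorem inner_transversalProj_comm (K : Fin 3 → ℤ) (x z : C3) :
    ⟪transversalProj K x, z⟫_ℂ = ⟪x, transversalProj K z⟫_ℂ := by
  have hxK : ⟪x, waveVecC K⟫_ℂ = (starRingEnd ℂ) (kdot K x) := by
    rw [← inner_conj_symm, inner_waveVecC_left]
  have hKz : ⟪waveVecC K, z⟫_ℂ = kdot K z := inner_waveVecC_left K z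
  have hr : (starRingEnd ℂ) ((Literature.Analysis.FunctionSpaces.Torus.freqNormSq K : ℂ)⁻¹) =
      ((Literature.Analysis.FunctionSpaces.Torus.freqNormSq K : ℂ)⁻¹) := by
    rw [map_inv₀, Complex.conj_ofReal]
  rw [transversalProj_apply, transversalProj_apply, inner_sub_left, inner_sub_right, inner_smul_left,
    inner_smul_right, hxK, hKz, map_mul, hr]
  ring

theorem freqNormSq_zero3 : Literature.Analysis.FunctionSpaces.Torus.freqNormSq (0 : Fin 3 → ℤ) = 0 := by
  simp [Literature.Analysis.FunctionSpaces.Torus.freqNormSq]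

theorem transversalProj_idem (K : Fin 3 → ℤ) (x : C3) :
    transversalProj K (transversalProj K x) = transversalProj K x := by
  by_cases hK : K = 0
  · subst hK
    simp [transversalProj_apply]
  · exact transversalProj_eq_self_of_kdot_eq_zero K (kdot_transversalProj hK x)

theorem transversalProj_eq_self_of_kdot (K : Fin 3 → ℤ) {v : C3} (hv : kdot K v = 0) :
    transversalProj K v = v :=
  transversalProj_eq_self_of_kdot_eq_zero K hv

/-! ## §2 Coercivity of the tree's modal generator on transversal vectors -/

/-- `4π²·lo·|K|²·‖w‖² ≤ Re⟪L_K w, w⟫` for transversal `w` under `NearIso 𝔸 lo hi`, `L_K = modalAdjGen 𝔸 K`. -/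
theorem re_inner_modalAdjGen_ge {𝔸 : Visc4 (Fin 3)} {lo hi : ℝ} (h𝔸 : NearIso 𝔸 lo hi) (K : Fin 3 → ℤ)
    {w : C3} (hw : kdot K w = 0) :
    4 * Real.pi ^ 2 * lo * (Literature.Analysis.FunctionSpaces.Torus.freqNormSq K * ‖w‖ ^ 2)
      ≤ (⟪modalAdjGen 𝔸 K w, w⟫_ℂ).re := by
  have hsym : (⟪modalAdjGen 𝔸 K w, w⟫_ℂ).re = (⟪w, modalAdjGen 𝔸 K w⟫_ℂ).re := by
    rw [← inner_conj_symm, Complex.conj_re]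
  have hz : ∑ j, (K j : ℂ) * w j = 0 := by rw [← kdot_apply]; exact hw
  have h1 := lo_mul_le_re_inner_symbT h𝔸 (k := K) (z := w) hz
  rw [hsym, re_inner_modalAdjGen_self 𝔸 K hw]
  have hpi : 0 ≤ 4 * Real.pi ^ 2 := by positivity
  nlinarith [mul_le_mul_of_nonneg_left h1 hpi]

/-- Transversality of the modal generator's output (by name). -/
theorem kdot_modalAdjGen_eq_zero (𝔸 : Visc4 (Fin 3)) {K : Fin 3 → ℤ} (hK : K ≠ 0) (w : C3) :
    kdot K (modalAdjGen 𝔸 K w) = 0 :=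
  kdot_modalAdjGen 𝔸 hK w

/-! ## §3 The concrete chain right-hand sides and cross term on `ℂ³` (real coefficients act through `(l : ℂ) •`) -/

/-- `ẇ₀ = −y₀ + l•P₀(w₊ − w₋)` on the fibre. -/
noncomputable def dW0C (l : ℝ) (K0 : Fin 3 → ℤ) (wp wm y0 : C3) : C3 := -y0 + (l : ℂ) • transversalProj K0 (wp - wm)
/-- `ẇ₊ = −y₊ − l•(P₊w₀ − P₊w₊₊)`. -/
noncomputable def dWpC (l : ℝ) (Kp : Fin 3 → ℤ) (w0 wpp yp : C3) : C3 :=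
  -yp - (l : ℂ) • (transversalProj Kp w0 - transversalProj Kp wpp)
/-- `ẇ₋ = −y₋ − l•(P₋w₋₋ − P₋w₀)`. -/
noncomputable def dWmC (l : ℝ) (Km : Fin 3 → ℤ) (w0 wmm ym : C3) : C3 :=
  -ym - (l : ℂ) • (transversalProj Km wmm - transversalProj Km w0)
/-- The cross vector `b = l•P₀(w₊ − w₋)`. -/
noncomputable def bC (l : ℝ) (K0 : Fin 3 → ℤ) (wp wm : C3) : C3 := (l : ℂ) • transversalProj K0 (wp - wm)
/-- `Ẋ` with `l` frozen: `Re⟪ẇ₀, b⟫ + Re⟪w₀, l•P₀(ẇ₊ − ẇ₋)⟫`. -/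
noncomputable def xdotC (l : ℝ) (K0 Kp Km : Fin 3 → ℤ) (w0 wp wm wpp wmm y0 yp ym : C3) : ℝ :=
  (⟪dW0C l K0 wp wm y0, bC l K0 wp wm⟫_ℂ).re
    + (⟪w0, (l : ℂ) • transversalProj K0 (dWpC l Kp w0 wpp yp - dWmC l Km w0 wmm ym)⟫_ℂ).re

/-! ## §4 The form inequality, the equivalence and the ramp pairing on the fibre -/

/-- **Three-mode form inequality on the Bloch fibre `ℂ³`** (instantiation of `threeModeV_form_le` with the Leray projections
`P_j = transversalProj K_j`; transversality as `kdot`-conditions; coercivity / norm bounds / window constants as in the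
abstract layer). -/
theorem threeModeC3_form_le (l e d0 dp dm dpp dmm dmin dtwo Dmax D0 : ℝ) (K0 Kp Km : Fin 3 → ℤ)
    (w0 wp wm wpp wmm y0 yp ym ypp ymm : C3)
    (hw0 : kdot K0 w0 = 0) (hyp : kdot Kp yp = 0) (hym : kdot Km ym = 0)
    (hl : 0 ≤ l) (he : 0 ≤ e) (hd0 : 0 ≤ d0) (hdmin : 0 ≤ dmin) (hD0 : 0 ≤ D0)
    (hg0 : d0 * ‖w0‖ ^ 2 ≤ (⟪y0, w0⟫_ℂ).re) (hgp : dp * ‖wp‖ ^ 2 ≤ (⟪yp, wp⟫_ℂ).re)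
    (hgm : dm * ‖wm‖ ^ 2 ≤ (⟪ym, wm⟫_ℂ).re) (hgpp : dpp * ‖wpp‖ ^ 2 ≤ (⟪ypp, wpp⟫_ℂ).re)
    (hgmm : dmm * ‖wmm‖ ^ 2 ≤ (⟪ymm, wmm⟫_ℂ).re)
    (hYp : ‖yp‖ ≤ Dmax * ‖wp‖) (hYm : ‖ym‖ ≤ Dmax * ‖wm‖) (hY0 : ‖y0‖ ≤ D0 * ‖w0‖)
    (hp : dmin ≤ dp) (hm : dmin ≤ dm) (hpp : dtwo ≤ dpp) (hmm : dtwo ≤ dmm)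
    (c1 : 8 * e * l ^ 2 ≤ dmin) (c2 : 4 * e * Dmax ^ 2 ≤ dmin) (c3 : e * l ^ 2 ≤ dtwo)
    (c4 : 32 * e ^ 2 * l ^ 2 * D0 ^ 2 ≤ d0 * dmin) :
    -2 * ((⟪y0, w0⟫_ℂ).re + (⟪yp, wp⟫_ℂ).re + (⟪ym, wm⟫_ℂ).re + (⟪ypp, wpp⟫_ℂ).re + (⟪ymm, wmm⟫_ℂ).re)
        + e * xdotC l K0 Kp Km w0 wp wm wpp wmm y0 yp ym
      ≤ -(e * l ^ 2 / 2) * (‖transversalProj Kp w0‖ ^ 2 + ‖transversalProj Km w0‖ ^ 2)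
        - (5 * dmin / 4) * (‖wp‖ ^ 2 + ‖wm‖ ^ 2) - dtwo * (‖wpp‖ ^ 2 + ‖wmm‖ ^ 2) - (7 * d0 / 4) * ‖w0‖ ^ 2 := by
  letI ipr : InnerProductSpace ℝ C3 := InnerProductSpace.rclikeToReal ℂ C3
  have hri : ∀ x z : C3, ⟪x, z⟫_ℝ = (⟪x, z⟫_ℂ).re := fun x z => real_inner_eq_re_inner ℂ x z
  have hsa : ∀ (K : Fin 3 → ℤ) (x z : C3),
      ⟪(fun v => transversalProj K v) x, z⟫_ℝ = ⟪x, (fun v => transversalProj K v) z⟫_ℝ := by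
    intro K x z; simp only [hri, inner_transversalProj_comm]
  have hid : ∀ (K : Fin 3 → ℤ) (x : C3),
      (fun v => transversalProj K v) ((fun v => transversalProj K v) x) = (fun v => transversalProj K v) x :=
    fun K x => transversalProj_idem K x
  have hw0' : (fun v => transversalProj K0 v) w0 = w0 := transversalProj_eq_self_of_kdot K0 hw0
  have hyp' : (fun v => transversalProj Kp v) yp = yp := transversalProj_eq_self_of_kdot Kp hyp
  have hym' : (fun v => transversalProj Km v) ym = ym := transversalProj_eq_self_of_kdot Km hym
  have h := threeModeV_form_le (E := C3) l e d0 dp dm dpp dmm dmin dtwo Dmax D0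
    (fun v => transversalProj K0 v) (fun v => transversalProj Kp v) (fun v => transversalProj Km v)
    w0 wp wm wpp wmm y0 yp ym ypp ymm
    (hsa K0) (hid K0) hw0' (hsa Kp) (hid Kp) hyp' (hsa Km) (hid Km) hym'
    hl he hd0 hdmin hD0
    (by rw [hri]; exact hg0) (by rw [hri]; exact hgp) (by rw [hri]; exact hgm) (by rw [hri]; exact hgpp)
    (by rw [hri]; exact hgmm) hYp hYm hY0 hp hm hpp hmm c1 c2 c3 c4
  have hsm : ∀ (r : ℝ) (v : C3), (@HSMul.hSMul ℝ C3 C3 (@instHSMul ℝ C3 ipr.toModule.toSMul) r v) = (r : ℂ) • v :=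
    fun r v => rfl
  have hx : xdotV (E := C3) l (fun v => transversalProj K0 v) (fun v => transversalProj Kp v)
      (fun v => transversalProj Km v) w0 wp wm wpp wmm y0 yp ym = xdotC l K0 Kp Km w0 wp wm wpp wmm y0 yp ym := by
    simp only [xdotV, xdotC, dW0, dWp, dWm, bV, dW0C, dWpC, dWmC, bC, hri, hsm]
  simpa only [hri, hx] using h

/-- **Norm equivalence of the cross term on the fibre**: `2|e·Re⟪w₀, b⟫| ≤ eℓ√2 (‖w₀‖² + ‖w₊‖² + ‖w₋‖²)`. -/
theorem threeModeC3_equiv (l e : ℝ) (K0 : Fin 3 → ℤ) (w0 wp wm : C3) (hl : 0 ≤ l) (he : 0 ≤ e) :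
    2 * |e * (⟪w0, bC l K0 wp wm⟫_ℂ).re| ≤ e * l * Real.sqrt 2 * (‖w0‖ ^ 2 + ‖wp‖ ^ 2 + ‖wm‖ ^ 2) := by
  letI ipr : InnerProductSpace ℝ C3 := InnerProductSpace.rclikeToReal ℂ C3
  have hri : ∀ x z : C3, ⟪x, z⟫_ℝ = (⟪x, z⟫_ℂ).re := fun x z => real_inner_eq_re_inner ℂ x z
  have hsa : ∀ (x z : C3), ⟪(fun v => transversalProj K0 v) x, z⟫_ℝ = ⟪x, (fun v => transversalProj K0 v) z⟫_ℝ := by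
    intro x z; simp only [hri, inner_transversalProj_comm]
  have hsm : ∀ (r : ℝ) (v : C3), (@HSMul.hSMul ℝ C3 C3 (@instHSMul ℝ C3 ipr.toModule.toSMul) r v) = (r : ℂ) • v :=
    fun r v => rfl
  have h := threeModeV_equiv (E := C3) l e (fun v => transversalProj K0 v) w0 wp wm hsa (transversalProj_idem K0) hl he
  have hb : bV (E := C3) l (fun v => transversalProj K0 v) wp wm = bC l K0 wp wm := by
    simp only [bV, bC, hsm]
  simpa only [hri, hb] using h

/-- **Ramp pairing on the fibre**: `|Re⟪w₀, P₀(w₊ − w₋)⟫| ≤ ‖w₀‖(‖w₊‖ + ‖w₋‖)`. -/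
theorem rampC3_pairing_le (K0 : Fin 3 → ℤ) (w0 wp wm : C3) :
    |(⟪w0, transversalProj K0 (wp - wm)⟫_ℂ).re| ≤ ‖w0‖ * (‖wp‖ + ‖wm‖) := by
  letI ipr : InnerProductSpace ℝ C3 := InnerProductSpace.rclikeToReal ℂ C3
  have hri : ∀ x z : C3, ⟪x, z⟫_ℝ = (⟪x, z⟫_ℂ).re := fun x z => real_inner_eq_re_inner ℂ x z
  have hsa : ∀ (x z : C3), ⟪(fun v => transversalProj K0 v) x, z⟫_ℝ = ⟪x, (fun v => transversalProj K0 v) z⟫_ℝ := by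
    intro x z; simp only [hri, inner_transversalProj_comm]
  have h := rampV_pairing_le (E := C3) (fun v => transversalProj K0 v) w0 wp wm hsa (transversalProj_idem K0)
  simpa only [hri] using h

/-! ## §5 Coercivity hypotheses discharged for the tree's generator (the `d_j` of the window) -/

/-- With `y_j := modalAdjGen 𝔸 K_j w_j` and `NearIso 𝔸 lo hi`, the coercivity hypotheses `hg_j` of `threeModeC3_form_le` hold with
`d_j := 4π²·lo·|K_j|²` for transversal `w_j` — packaged for the three chain modes and the two outer neighbours. -/
theorem coercivity_modalAdjGen {𝔸 : Visc4 (Fin 3)} {lo hi : ℝ} (h𝔸 : NearIso 𝔸 lo hi)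
    (K : Fin 3 → ℤ) (w : C3) (hw : kdot K w = 0) :
    (4 * Real.pi ^ 2 * lo * Literature.Analysis.FunctionSpaces.Torus.freqNormSq K) * ‖w‖ ^ 2
      ≤ (⟪modalAdjGen 𝔸 K w, w⟫_ℂ).re := by
  have := re_inner_modalAdjGen_ge h𝔸 K hw
  linarith [this]


/-! ## §F5 The UPPER norm bound of the modal generator on transversal vectors — discharges `Dmax`, `D0`
`‖modalAdjGen 𝔸 K w‖ ≤ 4π²·(hi + β/2)·|K|²·‖w‖` for `kdot K w = 0`, `NearIso 𝔸 lo hi` (`0 ≤ lo`, `0 ≤ hi`), `OddSmall 𝔸 β` (`0 ≤ β`):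
symmetric part by the Cauchy–Schwarz inequality of the (positive, by `0 ≤ lo`) transverse symbol form, odd part by `OddSmall`,
complex ↔ real parts by the bilinear version of `re_inner_symbT_eq`. -/

open Literature.Analysis.FunctionSpaces.Torus (freqNormSq freqNormSq_nonneg) in
/-- Additivity of the bilinear symbol in its first vector argument. -/
theorem bsymb_add_left (𝔸 : Visc4 (Fin 3)) (k p p' q : Fin 3 → ℝ) :
    bsymb 𝔸 k (p + p') q = bsymb 𝔸 k p q + bsymb 𝔸 k p' q := by
  simp only [bsymb, Pi.add_apply, add_mul, mul_add, Finset.sum_add_distrib]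

/-- Additivity of the bilinear symbol in its second vector argument. -/
theorem bsymb_add_right (𝔸 : Visc4 (Fin 3)) (k p q q' : Fin 3 → ℝ) :
    bsymb 𝔸 k p (q + q') = bsymb 𝔸 k p q + bsymb 𝔸 k p q' := by
  simp only [bsymb, Pi.add_apply, add_mul, mul_add, Finset.sum_add_distrib]

/-- Transversality is linear. -/
theorem transversal_add_smul (k p q : Fin 3 → ℝ) (t : ℝ) (hp : ∑ i, p i * k i = 0) (hq : ∑ i, q i * k i = 0) :
    ∑ i, (p + t • q) i * k i = 0 := by
  have : ∑ i, (p + t • q) i * k i = ∑ i, p i * k i + t * ∑ i, q i * k i := by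
    rw [Finset.mul_sum, ← Finset.sum_add_distrib]
    refine Finset.sum_congr rfl fun i _ => ?_
    simp only [Pi.add_apply, Pi.smul_apply, smul_eq_mul]; ring
  rw [this, hp, hq, mul_zero, add_zero]

/-- **Cauchy–Schwarz for the symmetrised transverse symbol** (positive by `0 ≤ lo`):
`(β(p,q) + β(q,p))² ≤ 4·(hi|k|²|p|²)·(hi|k|²|q|²)` for transversal `p, q`. -/
theorem bsymb_symm_sq_le {𝔸 : Visc4 (Fin 3)} {lo hi : ℝ} (h𝔸 : NearIso 𝔸 lo hi) (hlo : 0 ≤ lo)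
    (k p q : Fin 3 → ℝ) (hp : ∑ i, p i * k i = 0) (hq : ∑ i, q i * k i = 0) :
    (bsymb 𝔸 k p q + bsymb 𝔸 k q p) ^ 2
      ≤ 4 * (hi * ((∑ a, k a ^ 2) * ∑ i, p i ^ 2)) * (hi * ((∑ a, k a ^ 2) * ∑ i, q i ^ 2)) := by
  have hQ : ∀ t : ℝ, 0 ≤ symb 𝔸 k q * (t * t) + (bsymb 𝔸 k p q + bsymb 𝔸 k q p) * t + symb 𝔸 k p := by
    intro t
    have htr := transversal_add_smul k p q t hp hq
    have h0 : 0 ≤ symb 𝔸 k (p + t • q) :=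
      le_trans (mul_nonneg hlo (by positivity)) (h𝔸 k (p + t • q) htr).1
    have hexp : symb 𝔸 k (p + t • q)
        = symb 𝔸 k q * (t * t) + (bsymb 𝔸 k p q + bsymb 𝔸 k q p) * t + symb 𝔸 k p := by
      rw [symb_eq_bsymb, bsymb_add_left, bsymb_add_right, bsymb_add_right, bsymb_smul_left, bsymb_smul_right,
        bsymb_smul_right, bsymb_smul_left, ← symb_eq_bsymb, ← symb_eq_bsymb]
      ring
    linarith [h0, hexp]
  have hd := discrim_le_zero hQ
  rw [discrim] at hd
  have hQp : symb 𝔸 k p ≤ hi * ((∑ a, k a ^ 2) * ∑ i, p i ^ 2) := (h𝔸 k p hp).2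
  have hQq : symb 𝔸 k q ≤ hi * ((∑ a, k a ^ 2) * ∑ i, q i ^ 2) := (h𝔸 k q hq).2
  have hQp0 : 0 ≤ symb 𝔸 k p := le_trans (mul_nonneg hlo (by positivity)) (h𝔸 k p hp).1
  have hQq0 : 0 ≤ symb 𝔸 k q := le_trans (mul_nonneg hlo (by positivity)) (h𝔸 k q hq).1
  nlinarith [mul_le_mul hQq hQp hQp0 (le_trans hQq0 hQq)]

/-- `|x| ≤ B` from `x² ≤ B²` and `0 ≤ B`. -/
theorem abs_le_of_sq_le_sq'' {x B : ℝ} (h : x ^ 2 ≤ B ^ 2) (hB : 0 ≤ B) : |x| ≤ B := by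
  have := Real.sqrt_le_sqrt h
  rwa [Real.sqrt_sq_eq_abs, Real.sqrt_sq hB] at this

/-- **Bilinear bound of the transverse symbol**: `|β_𝔸(k; p, q)| ≤ (hi + β/2)·|k|²·|p|·|q|` for transversal `p, q`
under `NearIso 𝔸 lo hi` (`0 ≤ lo ≤`, `0 ≤ hi`) and `OddSmall 𝔸 β` (`0 ≤ β`). -/
theorem abs_bsymb_le {𝔸 : Visc4 (Fin 3)} {lo hi β : ℝ} (h𝔸 : NearIso 𝔸 lo hi) (hlo : 0 ≤ lo) (hhi : 0 ≤ hi)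
    (hodd : OddSmall 𝔸 β) (hβ : 0 ≤ β) (k p q : Fin 3 → ℝ) (hp : ∑ i, p i * k i = 0) (hq : ∑ i, q i * k i = 0) :
    |bsymb 𝔸 k p q| ≤ (hi + β / 2) * (∑ a, k a ^ 2) * (Real.sqrt (∑ i, p i ^ 2) * Real.sqrt (∑ i, q i ^ 2)) := by
  have hK2 : 0 ≤ ∑ a, k a ^ 2 := by positivity
  have hP2 : 0 ≤ ∑ i, p i ^ 2 := by positivity
  have hQ2 : 0 ≤ ∑ i, q i ^ 2 := by positivity
  have hSP := Real.sq_sqrt hP2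
  have hSQ := Real.sq_sqrt hQ2
  have hsP := Real.sqrt_nonneg (∑ i, p i ^ 2)
  have hsQ := Real.sqrt_nonneg (∑ i, q i ^ 2)
  -- symmetric part
  have hs : |bsymb 𝔸 k p q + bsymb 𝔸 k q p| ≤ 2 * hi * (∑ a, k a ^ 2) * (Real.sqrt (∑ i, p i ^ 2) * Real.sqrt (∑ i, q i ^ 2)) := by
    have h := bsymb_symm_sq_le h𝔸 hlo k p q hp hq
    refine abs_le_of_sq_le_sq'' ?_ (by positivity)
    calc (bsymb 𝔸 k p q + bsymb 𝔸 k q p) ^ 2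
        ≤ 4 * (hi * ((∑ a, k a ^ 2) * ∑ i, p i ^ 2)) * (hi * ((∑ a, k a ^ 2) * ∑ i, q i ^ 2)) := h
      _ = (2 * hi * (∑ a, k a ^ 2) * (Real.sqrt (∑ i, p i ^ 2) * Real.sqrt (∑ i, q i ^ 2))) ^ 2 := by
          rw [show (2 * hi * (∑ a, k a ^ 2) * (Real.sqrt (∑ i, p i ^ 2) * Real.sqrt (∑ i, q i ^ 2))) ^ 2
              = 4 * hi ^ 2 * (∑ a, k a ^ 2) ^ 2 * (Real.sqrt (∑ i, p i ^ 2) ^ 2 * Real.sqrt (∑ i, q i ^ 2) ^ 2) by ring,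
            hSP, hSQ]
          ring
  -- odd part
  have ho : |bsymb 𝔸 k p q - bsymb 𝔸 k q p| ≤ β * (∑ a, k a ^ 2) * (Real.sqrt (∑ i, p i ^ 2) * Real.sqrt (∑ i, q i ^ 2)) := by
    have h := hodd k p q hp hq
    refine abs_le_of_sq_le_sq'' ?_ (by positivity)
    calc (bsymb 𝔸 k p q - bsymb 𝔸 k q p) ^ 2
        ≤ β ^ 2 * ((∑ a, k a ^ 2) ^ 2 * ((∑ i, p i ^ 2) * (∑ i, q i ^ 2))) := h
      _ = (β * (∑ a, k a ^ 2) * (Real.sqrt (∑ i, p i ^ 2) * Real.sqrt (∑ i, q i ^ 2))) ^ 2 := by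
          rw [show (β * (∑ a, k a ^ 2) * (Real.sqrt (∑ i, p i ^ 2) * Real.sqrt (∑ i, q i ^ 2))) ^ 2
              = β ^ 2 * (∑ a, k a ^ 2) ^ 2 * (Real.sqrt (∑ i, p i ^ 2) ^ 2 * Real.sqrt (∑ i, q i ^ 2) ^ 2) by ring,
            hSP, hSQ]
          ring
  have hsplit : bsymb 𝔸 k p q = ((bsymb 𝔸 k p q + bsymb 𝔸 k q p) + (bsymb 𝔸 k p q - bsymb 𝔸 k q p)) / 2 := by ring
  rw [hsplit, abs_div, abs_two]
  have := abs_add_le (bsymb 𝔸 k p q + bsymb 𝔸 k q p) (bsymb 𝔸 k p q - bsymb 𝔸 k q p)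
  have hR : 0 ≤ (∑ a, k a ^ 2) * (Real.sqrt (∑ i, p i ^ 2) * Real.sqrt (∑ i, q i ^ 2)) := by positivity
  nlinarith [hs, ho, this, hR]

/-- `Re((r v) ū) = r (Re u Re v + Im u Im v)` for real `r` (local copy of the tree's private helper). -/
theorem re_ofReal_mul_mul_conj' (r : ℝ) (u v : ℂ) :
    ((r : ℂ) * v * (starRingEnd ℂ) u).re = r * (u.re * v.re + u.im * v.im) := by
  simp [Complex.mul_re, Complex.mul_im]
  ring

/-- **Bilinear version of `re_inner_symbT_eq`**: `Re⟪u, T_𝔸(k) w⟫ = β_𝔸(k; Re w, Re u) + β_𝔸(k; Im w, Im u)`. -/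
theorem re_inner_symbT_bilin (𝔸 : Visc4 (Fin 3)) (k : Fin 3 → ℤ) (u w : C3) :
    (⟪u, symbT 𝔸 k w⟫_ℂ).re
      = bsymb 𝔸 (fun a => (k a : ℝ)) (fun i => (w i).re) (fun j => (u j).re)
        + bsymb 𝔸 (fun a => (k a : ℝ)) (fun i => (w i).im) (fun j => (u j).im) := by
  have h1 : (⟪u, symbT 𝔸 k w⟫_ℂ).re =
      ∑ j, ∑ i, ∑ a, ∑ b, (𝔸 i a j b * (k a : ℝ) * (k b : ℝ)) * ((u j).re * (w i).re + (u j).im * (w i).im) := by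
    rw [PiLp.inner_apply, Complex.re_sum]
    refine Finset.sum_congr rfl fun j _ => ?_
    rw [RCLike.inner_apply, symbT_apply, Finset.sum_mul, Complex.re_sum]
    refine Finset.sum_congr rfl fun i _ => ?_
    rw [Finset.sum_mul, Complex.re_sum]
    refine Finset.sum_congr rfl fun a _ => ?_
    rw [Finset.sum_mul, Complex.re_sum]
    refine Finset.sum_congr rfl fun b _ => ?_
    exact re_ofReal_mul_mul_conj' _ _ _
  rw [h1, Finset.sum_comm]
  simp only [bsymb, ← Finset.sum_add_distrib]
  refine Finset.sum_congr rfl fun i _ => ?_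
  rw [Finset.sum_comm]
  refine Finset.sum_congr rfl fun a _ => Finset.sum_congr rfl fun j _ =>
    Finset.sum_congr rfl fun b _ => ?_
  ring

/-- Transversality of a complex vector passes to its real and imaginary parts (local copy of the tree's private helper). -/
theorem re_im_transversal {k : Fin 3 → ℤ} {z : C3} (hz : kdot k z = 0) :
    ∑ i, (z i).re * (k i : ℝ) = 0 ∧ ∑ i, (z i).im * (k i : ℝ) = 0 := by
  rw [kdot_apply] at hz
  have hre := congrArg Complex.re hz
  have him := congrArg Complex.im hz
  rw [Complex.re_sum, Complex.zero_re] at hre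
  rw [Complex.im_sum, Complex.zero_im] at him
  constructor
  · rw [← hre]
    refine Finset.sum_congr rfl fun i _ => ?_
    rw [← Complex.ofReal_intCast, Complex.re_ofReal_mul, mul_comm]
  · rw [← him]
    refine Finset.sum_congr rfl fun i _ => ?_
    rw [← Complex.ofReal_intCast, Complex.im_ofReal_mul, mul_comm]

/-- `‖z‖² = Σ (Re zᵢ)² + Σ (Im zᵢ)²` on `ℂ³`. -/
theorem norm_sq_re_im (z : C3) : ‖z‖ ^ 2 = ∑ i, (z i).re ^ 2 + ∑ i, (z i).im ^ 2 := by
  rw [EuclideanSpace.norm_sq_eq, ← Finset.sum_add_distrib]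
  refine Finset.sum_congr rfl fun i _ => ?_
  rw [Complex.sq_norm, Complex.normSq_apply]
  ring

/-- Cauchy–Schwarz in `ℝ²` with square roots: `√a√c + √b√d ≤ √(a+b)·√(c+d)` for `a b c d ≥ 0`. -/
theorem sqrt_mul_add_sqrt_mul_le {a b c d : ℝ} (ha : 0 ≤ a) (hb : 0 ≤ b) (hc : 0 ≤ c) (hd : 0 ≤ d) :
    Real.sqrt a * Real.sqrt c + Real.sqrt b * Real.sqrt d ≤ Real.sqrt (a + b) * Real.sqrt (c + d) := by
  set x := Real.sqrt a; set y := Real.sqrt b; set z := Real.sqrt c; set t := Real.sqrt d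
  have hx : x ^ 2 = a := Real.sq_sqrt ha
  have hy : y ^ 2 = b := Real.sq_sqrt hb
  have hz : z ^ 2 = c := Real.sq_sqrt hc
  have ht : t ^ 2 = d := Real.sq_sqrt hd
  have h0 : 0 ≤ x * z + y * t := by positivity
  have hsq : (x * z + y * t) ^ 2 ≤ (a + b) * (c + d) := by
    rw [← hx, ← hy, ← hz, ← ht]; nlinarith [sq_nonneg (x * t - y * z)]
  have := Real.sqrt_le_sqrt hsq
  rwa [Real.sqrt_sq h0, Real.sqrt_mul (by positivity)] at this

open Literature.Analysis.FunctionSpaces.Torus (freqNormSq) in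
/-- **`Re⟪u, T_𝔸(K) w⟫ ≤ (hi + β/2)·|K|²·‖w‖·‖u‖` for transversal `u, w`** (the bilinear window bound). -/
theorem re_inner_symbT_le {𝔸 : Visc4 (Fin 3)} {lo hi β : ℝ} (h𝔸 : NearIso 𝔸 lo hi) (hlo : 0 ≤ lo) (hhi : 0 ≤ hi)
    (hodd : OddSmall 𝔸 β) (hβ : 0 ≤ β) (K : Fin 3 → ℤ) {u w : C3} (hu : kdot K u = 0) (hw : kdot K w = 0) :
    (⟪u, symbT 𝔸 K w⟫_ℂ).re ≤ (hi + β / 2) * freqNormSq K * (‖w‖ * ‖u‖) := by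
  obtain ⟨hur, hui⟩ := re_im_transversal hu
  obtain ⟨hwr, hwi⟩ := re_im_transversal hw
  have hK : (∑ a, ((fun a => (K a : ℝ)) a) ^ 2) = freqNormSq K := by simp [freqNormSq]
  have h1 := abs_bsymb_le h𝔸 hlo hhi hodd hβ (fun a => (K a : ℝ)) (fun i => (w i).re) (fun j => (u j).re) hwr hur
  have h2 := abs_bsymb_le h𝔸 hlo hhi hodd hβ (fun a => (K a : ℝ)) (fun i => (w i).im) (fun j => (u j).im) hwi hui
  rw [hK] at h1 h2
  have hcs := sqrt_mul_add_sqrt_mul_le (a := ∑ i, (w i).re ^ 2) (b := ∑ i, (w i).im ^ 2)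
    (c := ∑ i, (u i).re ^ 2) (d := ∑ i, (u i).im ^ 2) (by positivity) (by positivity) (by positivity) (by positivity)
  have hwn : Real.sqrt (∑ i, (w i).re ^ 2 + ∑ i, (w i).im ^ 2) = ‖w‖ := by
    rw [← norm_sq_re_im, Real.sqrt_sq (norm_nonneg _)]
  have hun : Real.sqrt (∑ i, (u i).re ^ 2 + ∑ i, (u i).im ^ 2) = ‖u‖ := by
    rw [← norm_sq_re_im, Real.sqrt_sq (norm_nonneg _)]
  rw [hwn, hun] at hcs
  rw [re_inner_symbT_bilin]
  have hc : 0 ≤ (hi + β / 2) * freqNormSq K := mul_nonneg (by linarith) (Literature.Analysis.FunctionSpaces.Torus.freqNormSq_nonneg K)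
  calc bsymb 𝔸 (fun a => (K a : ℝ)) (fun i => (w i).re) (fun j => (u j).re)
        + bsymb 𝔸 (fun a => (K a : ℝ)) (fun i => (w i).im) (fun j => (u j).im)
      ≤ (hi + β / 2) * freqNormSq K * (Real.sqrt (∑ i, (w i).re ^ 2) * Real.sqrt (∑ i, (u i).re ^ 2))
        + (hi + β / 2) * freqNormSq K * (Real.sqrt (∑ i, (w i).im ^ 2) * Real.sqrt (∑ i, (u i).im ^ 2)) :=
        add_le_add (le_trans (le_abs_self _) h1) (le_trans (le_abs_self _) h2)
    _ = (hi + β / 2) * freqNormSq K * (Real.sqrt (∑ i, (w i).re ^ 2) * Real.sqrt (∑ i, (u i).re ^ 2)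
        + Real.sqrt (∑ i, (w i).im ^ 2) * Real.sqrt (∑ i, (u i).im ^ 2)) := by ring
    _ ≤ (hi + β / 2) * freqNormSq K * (‖w‖ * ‖u‖) := mul_le_mul_of_nonneg_left hcs hc

open Literature.Analysis.FunctionSpaces.Torus (freqNormSq) in
/-- **UPPER NORM BOUND of the modal generator on transversal vectors** — the `Dmax`/`D0` hypotheses of `threeModeC3_form_le`
for `y_j := modalAdjGen 𝔸 K_j w_j`: `‖L_K w‖ ≤ 4π²·(hi + β/2)·|K|²·‖w‖` (`kdot K w = 0`, `NearIso 𝔸 lo hi` with `0 ≤ lo`, `0 ≤ hi`,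
`OddSmall 𝔸 β` with `0 ≤ β`). -/
theorem norm_modalAdjGen_le {𝔸 : Visc4 (Fin 3)} {lo hi β : ℝ} (h𝔸 : NearIso 𝔸 lo hi) (hlo : 0 ≤ lo) (hhi : 0 ≤ hi)
    (hodd : OddSmall 𝔸 β) (hβ : 0 ≤ β) (K : Fin 3 → ℤ) (w : C3) (hw : kdot K w = 0) :
    ‖modalAdjGen 𝔸 K w‖ ≤ 4 * Real.pi ^ 2 * (hi + β / 2) * freqNormSq K * ‖w‖ := by
  by_cases hK : K = 0
  · subst hK
    simp [modalAdjGen_apply, freqNormSq]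
  have hu : kdot K (modalAdjGen 𝔸 K w) = 0 := kdot_modalAdjGen 𝔸 hK w
  have e1 : (⟪modalAdjGen 𝔸 K w, modalAdjGen 𝔸 K w⟫_ℂ).re = ‖modalAdjGen 𝔸 K w‖ ^ 2 := by
    have := inner_self_eq_norm_sq (𝕜 := ℂ) (modalAdjGen 𝔸 K w)
    simpa using this
  have e2 : (⟪modalAdjGen 𝔸 K w, modalAdjGen 𝔸 K w⟫_ℂ).re
      = 4 * Real.pi ^ 2 * (⟪modalAdjGen 𝔸 K w, symbT 𝔸 K w⟫_ℂ).re := by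
    have : ⟪modalAdjGen 𝔸 K w, modalAdjGen 𝔸 K w⟫_ℂ
        = ⟪modalAdjGen 𝔸 K w, ((4 * Real.pi ^ 2 : ℝ) : ℂ) • transversalProj K (symbT 𝔸 K w)⟫_ℂ := rfl
    rw [this, inner_smul_right, ← inner_transversalProj_comm, transversalProj_eq_self_of_kdot K hu, Complex.re_ofReal_mul]
  have h3 := re_inner_symbT_le h𝔸 hlo hhi hodd hβ K hu hw
  have hsq : ‖modalAdjGen 𝔸 K w‖ ^ 2 ≤ (4 * Real.pi ^ 2 * (hi + β / 2) * freqNormSq K * ‖w‖) * ‖modalAdjGen 𝔸 K w‖ := by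
    rw [← e1, e2]
    have hpi : 0 ≤ 4 * Real.pi ^ 2 := by positivity
    nlinarith [mul_le_mul_of_nonneg_left h3 hpi]
  have hR : 0 ≤ 4 * Real.pi ^ 2 * (hi + β / 2) * freqNormSq K * ‖w‖ := by
    have := Literature.Analysis.FunctionSpaces.Torus.freqNormSq_nonneg K
    have : 0 ≤ hi + β / 2 := by linarith
    positivity
  by_cases h0 : ‖modalAdjGen 𝔸 K w‖ = 0
  · rw [h0]; exact hR
  · have hpos : 0 < ‖modalAdjGen 𝔸 K w‖ := lt_of_le_of_ne (norm_nonneg _) (Ne.symm h0)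
    rw [pow_two] at hsq
    exact le_of_mul_le_mul_right hsq hpos

end Fibre

end Summit.AnomalousDissipation.AnomalousDissipation.Cruxes.LagrangianRenormalisationStep.ThreeMode
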